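import Summits.AtomisticToContinuum.Crystallization.Theorems.SquareWellLayerCakeGapTwelveToBarlowCombinatorialLayeringTransportSteps1

/-!
# Combinatorial layering (B1a of `GapTwelveToBarlow`): transport port, part `Steps3`

Crux `SquareWellLayerCake.GapTwelveToBarlow` (stmt-AtomisticToContinuum-15807), line `Sketch`,
stub `stub_combinatorialLayering`, residual `(H_develop)`.  PORT of the tree file
`PalmUnimodularRigidityShellsToBarlowChartTransportSteps3.lean` (crux 9227) to GRADED COMBINATORIAL
charts, following the port rules recorded in `…CombinatorialLayeringTransportSteps1` (bundled
standing hypothesis `hch` on `S : ℕ → Set E3`, abstract bond relation `B`, memberships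
`x ∈ S (n + k)`, transfer as an input).  Statements and proofs are otherwise those of the source,
whose documentation follows.

# Line `develop-the-model-growth-descent` (crux `ShellsToBarlowChart`, stmt-AtomisticToContinuum-9227): the four in-layer transports `I, J, I⁻¹, J⁻¹` and the vertical transport `V` of frames read in integer charts (specifications, inverse identities, apexes) (part 3/7)

Helper lemmas for `stub_transportSystem` (the geometric half of the line): frames `⟨x, t₁, t₂, U⟩`
read in the integer charts `IsZChart` of a good-shell configuration, their transports and the
coherence of the resulting development `frameAt`.  The only metric inputs are the chart transfer
lemma and `bond_nb_iff`; everything else is label combinatorics in `ℤ³` (pattern facts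
`TransportPatterns*`).  All `[folklore]` (HalesDSP2012 §1.3 for the two kissing patterns).
-/

noncomputable section

namespace Summit.AtomisticToContinuum.Crystallization.Theorems.SquareWellLayerCakeGapTwelveToBarlow

open Literature.Geometry.DiscreteGeometry Literature.MathematicalPhysics.StatisticalMechanics
open Summit.AtomisticToContinuum.Crystallization.Theorems.PalmUnimodularRigidityShellsToBarlowChart hiding
  IsZChart TransportSystem scales_tied sqNormInt_transfer bond_symm nb_mem zlab_spec zlab_nb
  bond_nb_iff pattern_cases transfer_nb_nb transfer_nb_centre transfer_nb_target
  sqNormInt_zlab_centre hcp_of_mirror_pair Istep_spec Jstep_spec IinvStep_spec JinvStep_spec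
  capWithAny_of_mem_cap IinvStep_Istep Istep_IinvStep JinvStep_Jstep Jstep_JinvStep polar_at_apex
  onesided_at_apex Vstep_spec nb_inj Istep_lower Jstep_lower IinvStep_lower JinvStep_lower
  polar_at_lower_apex onesided_at_lower_apex VinvStep_spec attach_I_even attach_I_odd
  attach_lower_I_pos attach_lower_I_neg attach_J_even attach_J_odd Vstep_Istep_pt Vstep_Istep_back
  Vstep_Istep_side Vstep_Jstep_pt Vstep_Istep_comm Vstep_Jstep_comm attach_lower_J_pos
  attach_lower_J_neg VinvStep_Istep_pt VinvStep_Jstep_pt VinvStep_Istep_back VinvStep_Istep_side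
  VinvStep_Istep_comm VinvStep_Jstep_comm Istep_Jstep_comm

variable {S : ℕ → Set (EuclideanSpace ℝ (Fin 3))}
  {B : EuclideanSpace ℝ (Fin 3) → EuclideanSpace ℝ (Fin 3) → Prop}
  {Pc : EuclideanSpace ℝ (Fin 3) → Finset (Fin 3 → ℤ)}
  {nb : EuclideanSpace ℝ (Fin 3) → (Fin 3 → ℤ) → EuclideanSpace ℝ (Fin 3)}

variable
  (hch : (∀ n : ℕ, ∀ z ∈ S n, (Pc z = fcc3Int ∨ Pc z = hcpInt) ∧
      Set.BijOn (nb z) (↑(Pc z) : Set (Fin 3 → ℤ)) {y | B z y} ∧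
      ∀ t ∈ Pc z, ∀ t' ∈ Pc z, (B (nb z t) (nb z t') ↔ sqNormInt (t - t') = 18)) ∧
    (∀ n : ℕ, ∀ z ∈ S (n + 1), ∀ y, B z y → y ∈ S n) ∧
    (∀ n m : ℕ, ∀ x ∈ S n, ∀ y ∈ S m, B x y →
      ∀ (z z' : EuclideanSpace ℝ (Fin 3)) (t t' u u' : Fin 3 → ℤ),
        (t = 0 ∧ z = x ∨ t ∈ Pc x ∧ z = nb x t) → (t' = 0 ∧ z' = x ∨ t' ∈ Pc x ∧ z' = nb x t') →
        (u = 0 ∧ z = y ∨ u ∈ Pc y ∧ z = nb y u) → (u' = 0 ∧ z' = y ∨ u' ∈ Pc y ∧ z' = nb y u') →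
        sqNormInt (u - u') = sqNormInt (t - t')) ∧
    (∀ x y, B x y → B y x))

include hch


/-- **The J-step.**  For a valid frame `⟨x, t₁, t₂, U⟩` in the admissible regime (the target
pattern is FCC, or the source pattern is HCP, or — for the upper layers of the development — the
labels at the target of `x` and `nb x t₂` are already known to be symmetric), `Jstep` lands at
the bonded site `y = nb x t₂`,
produces a valid frame of the SAME parity, the type propagates (`x` HCP ⇒ `y` HCP), and the
labels at `y` of `x`, `nb x t₁`, `nb x (t₂ − t₁)` are `w`, `v`, `w − v` with `−w, −v` labels;
moreover the new upper cap is the cap of the label `μ` of the transported reference `nb x c₂`,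
`c₂` the unique `U`-element touching `t₂`, and `μ` is its unique element touching `w`.
[folklore] -/
theorem Jstep_spec {n : ℕ} {x : (EuclideanSpace ℝ (Fin 3))} (hx : x ∈ S (n + 1)) {t₁ t₂ : Fin 3 → ℤ} {U : Finset (Fin 3 → ℤ)} (hU : IsFrame (Pc x) t₁ t₂ U) (hreg : Pc (nb x t₂) = fcc3Int ∨ Pc x = hcpInt ∨ (-zlab Pc nb (nb x t₂) x ∈ Pc (nb x t₂) ∧ -zlab Pc nb (nb x t₂) (nb x t₁) ∈ Pc (nb x t₂))) : nb x t₂ ∈ S n ∧ (B x (nb x t₂)) ∧ zlab Pc nb (nb x t₂) x ∈ Pc (nb x t₂) ∧ nb (nb x t₂) (zlab Pc nb (nb x t₂) x) = x ∧ zlab Pc nb (nb x t₂) (nb x t₁) ∈ Pc (nb x t₂) ∧ nb (nb x t₂) (zlab Pc nb (nb x t₂) (nb x t₁)) = nb x t₁ ∧ -zlab Pc nb (nb x t₂) x ∈ Pc (nb x t₂) ∧ -zlab Pc nb (nb x t₂) (nb x t₁) ∈ Pc (nb x t₂) ∧ sqNormInt (zlab Pc nb (nb x t₂) x - zlab Pc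 nb (nb x t₂) (nb x t₁)) = 18 ∧ zlab Pc nb (nb x t₂) (nb x (t₂ - t₁)) = zlab Pc nb (nb x t₂) x - zlab Pc nb (nb x t₂) (nb x t₁) ∧ (Pc x = hcpInt → Pc (nb x t₂) = hcpInt) ∧ IsFrame (Pc (nb x t₂)) (Jstep Pc nb ⟨x, t₁, t₂, U⟩).t₁ (Jstep Pc nb ⟨x, t₁, t₂, U⟩).t₂ (Jstep Pc nb ⟨x, t₁, t₂, U⟩).U ∧ frameParity (Jstep Pc nb ⟨x, t₁, t₂, U⟩).t₁ (Jstep Pc nb ⟨x, t₁, t₂, U⟩).t₂ (Jstep Pc nb ⟨x, t₁, t₂, U⟩).U = frameParity t₁ t₂ U ∧ ∃ c₂ ∈ U, sqNormInt (c₂ - t₂) = 18 ∧ U.filter (fun e => sqNormInt (e - t₂) = 18) = {c₂} ∧ (B (nb x t₂) (nb x c₂)) ∧ zlab Pc nb (nb x t₂) (nb x c₂) ∈ (Jstep Pc nb ⟨x, t₁, t₂, U⟩).U ∧ (Jstep Pc nb ⟨x, t₁, t₂, U⟩).U = capWithAny (Pc (nb x t₂)) (Jstep Pc nb ⟨x,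 t₁, t₂, U⟩).t₁ (Jstep Pc nb ⟨x, t₁, t₂, U⟩).t₂ {zlab Pc nb (nb x t₂) (nb x c₂)} ∧ (Jstep Pc nb ⟨x, t₁, t₂, U⟩).U.filter (fun e => sqNormInt (e + (Jstep Pc nb ⟨x, t₁, t₂, U⟩).t₂) = 18) = {zlab Pc nb (nb x t₂) (nb x c₂)} := by
  obtain ⟨h12, hhex, hUP, hoff, c, hcU, hform⟩ := hU
  have hPx := pattern_cases hch hx
  -- hexagon memberships at `x`
  have ht₁ : t₁ ∈ Pc x := hhex (mem_hexLabels_iff.2 (Or.inl rfl))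
  have ht₂ : t₂ ∈ Pc x := hhex (mem_hexLabels_iff.2 (Or.inr (Or.inl rfl)))
  have ht21 : t₂ - t₁ ∈ Pc x := hhex (mem_hexLabels_iff.2 (Or.inr (Or.inr (Or.inl rfl))))
  have hcP : c ∈ Pc x := hUP hcU
  have hc : c ∉ hexLabels t₁ t₂ := hoff c hcU
  have hhx := dist_hexagon (Pc x) hPx t₁ ht₁ t₂ ht₂ h12 hhex
  -- the new site
  have hy := nb_mem hch hx ht₂
  have hPy := pattern_cases hch hy.1
  -- bonds from `y` to `I = nb x t₁`, `K = nb x (t₂ - t₁)`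
  have h21 : sqNormInt (t₂ - t₁) = 18 := by rw [sqNormInt_sub_comm]; exact h12
  have hbJ : B (nb x t₂) (nb x t₁) :=
    (bond_nb_iff hch hx ht₂ ht₁).2 h21
  have hbK : B (nb x t₂) (nb x (t₂ - t₁)) :=
    (bond_nb_iff hch hx ht₂ ht21).2 hhx.2.2.2.2.2.2.1
  -- labels at `y`
  have hw := zlab_spec hch hy.1 hx (bond_symm hch hy.2)
  have hv := zlab_spec hch hy.1 (nb_mem hch hx ht₁).1 hbJ
  have hκ := zlab_spec hch hy.1 (nb_mem hch hx ht21).1 hbK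
  set w := zlab Pc nb (nb x t₂) x with hw_def
  set v := zlab Pc nb (nb x t₂) (nb x t₁) with hv_def
  set κ := zlab Pc nb (nb x t₂) (nb x (t₂ - t₁)) with hκ_def
  -- transfers among `x, I, K`
  have Dvw : sqNormInt (v - w) = 18 := by
    rw [hv_def, hw_def, transfer_nb_centre hch hx hy.1 hy.2 ht₁ hbJ, hhx.1]
  have Dwv : sqNormInt (w - v) = 18 := by rw [sqNormInt_sub_comm]; exact Dvw
  have Dκw : sqNormInt (κ - w) = 18 := by
    rw [hκ_def, hw_def, transfer_nb_centre hch hx hy.1 hy.2 ht21 hbK, h21]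
  have Dvκ : sqNormInt (v - κ) = 54 := by
    rw [hv_def, hκ_def, transfer_nb_nb hch hx hy.1 hy.2 ht₁ ht21 hbJ hbK]
    exact hhx.2.2.2.2.2.2.2.1
  have Dκv : sqNormInt (κ - v) = 54 := by rw [sqNormInt_sub_comm]; exact Dvκ
  -- the parity split on the source cap
  rcases hform with hE | hO
  · /- EVEN source cap `U = {c, c - t₁, c - t₂}`: reference `c₂ = c` -/
    have hc1 : c - t₁ ∈ Pc x := hUP (by rw [hE]; simp)
    have hc2 : c - t₂ ∈ Pc x := hUP (by rw [hE]; simp)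
    have hdx := dist_evenCap (Pc x) hPx t₁ ht₁ t₂ ht₂ c hcP h12 hhex hc hc1 hc2
    have hbu : B (nb x t₂) (nb x c) :=
      (bond_nb_iff hch hx ht₂ hcP).2 (by exact hdx.1)
    have hμ := zlab_spec hch hy.1 (nb_mem hch hx hcP).1 hbu
    set μ := zlab Pc nb (nb x t₂) (nb x c) with hμ_def
    have Dμw : sqNormInt (μ - w) = 18 := by
      rw [hμ_def, hw_def, transfer_nb_centre hch hx hy.1 hy.2 hcP hbu]
      exact chart_sqNormInt_eq hch hx hcP
    have Dwμ : sqNormInt (w - μ) = 18 := by rw [sqNormInt_sub_comm]; exact Dμw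
    have Dvμ : sqNormInt (v - μ) = 18 := by
      rw [hv_def, hμ_def, transfer_nb_nb hch hx hy.1 hy.2 ht₁ hcP hbJ hbu]; exact hdx.2.1
    -- regime: symmetric labels at `y` and type propagation
    have hsym : -w ∈ Pc (nb x t₂) ∧ -v ∈ Pc (nb x t₂) ∧ (Pc x = hcpInt → Pc (nb x t₂) = hcpInt) := by
      by_cases hxh : Pc x = hcpInt
      · -- mirror pair through the lower cap
        have hfr : ∀ q, q ∈ hcpInt ↔ q ∈ Pc x := fun q => by rw [hxh]
        obtain ⟨d, hd, h48, hd1, hd2, hdoff, hL⟩ := lowerCap_evenCap_hcp t₁ ((hfr _).2 ht₁) t₂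
          ((hfr _).2 ht₂) c ((hfr _).2 hcP) h12 (by rw [hxh] at hhex; exact hhex) hc
          ((hfr _).2 hc1) ((hfr _).2 hc2)
        have hdP : d ∈ Pc x := (hfr d).1 (mem_lowerCap_iff.1 hd).1
        have hdx' := dist_evenCap (Pc x) hPx t₁ ht₁ t₂ ht₂ d hdP h12 hhex hdoff ((hfr _).1 hd1)
          ((hfr _).1 hd2)
        have hbl : B (nb x t₂) (nb x d) :=
          (bond_nb_iff hch hx ht₂ hdP).2 (by exact hdx'.1)
        obtain ⟨hPy', heq⟩ := hcp_of_mirror_pair hch hx ht₂ hcP hdP h48 hbu hbl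
        have hlam := zlab_spec hch hy.1 (nb_mem hch hx hdP).1 hbl
        have Dwlam : sqNormInt (w - zlab Pc nb (nb x t₂) (nb x d)) = 18 := by
          rw [sqNormInt_sub_comm, hw_def, transfer_nb_centre hch hx hy.1 hy.2 hdP hbl]
          exact chart_sqNormInt_eq hch hx hdP
        have Dvlam : sqNormInt (v - zlab Pc nb (nb x t₂) (nb x d)) = 18 := by
          rw [hv_def, transfer_nb_nb hch hx hy.1 hy.2 ht₁ hdP hbJ hbl]; exact hdx'.2.1
        exact ⟨heq w hw.1 Dwμ Dwlam, heq v hv.1 Dvμ Dvlam, fun _ => hPy'⟩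
      · have hS : -w ∈ Pc (nb x t₂) ∧ -v ∈ Pc (nb x t₂) := by
          rcases hreg with hA | hB | hS
          · constructor
            · rw [hA] at hw ⊢; exact neg_mem_fcc3Int w hw.1
            · rw [hA] at hv ⊢; exact neg_mem_fcc3Int v hv.1
          · exact (hxh hB).elim
          · exact hS
        exact ⟨hS.1, hS.2, fun h => (hxh h).elim⟩
    obtain ⟨hnw, hnv, htype⟩ := hsym
    -- hexagon at `y` and the identity `κ = w - v`
    have hhexwv : hexLabels w v ⊆ Pc (nb x t₂) :=
      hexLabels_subset_of_symm (Pc (nb x t₂)) hPy w hw.1 v hv.1 Dwv hnw hnv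
    have hwv : w - v ∈ Pc (nb x t₂) :=
      hhexwv (mem_hexLabels_iff.2 (Or.inr (Or.inr (Or.inr (Or.inr (Or.inr rfl))))))
    have hκeq : κ = w - v :=
      label_third_vertex (Pc (nb x t₂)) hPy v hv.1 w hw.1 κ hκ.1 Dvw Dκw Dκv hwv
    -- the apex fact at `y` (J-orientation: frame `(v - w, -w)`)
    obtain ⟨hframe, hpar, hcap⟩ :=
      apex_J_even (Pc (nb x t₂)) hPy w hw.1 v hv.1 μ hμ.1 hnw hnv Dwv Dwμ Dvμ
    obtain ⟨-, -, -, hapoff, hμw, hμv⟩ :=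
      apex_I_even (Pc (nb x t₂)) hPy w hw.1 v hv.1 μ hμ.1 hnw hnv Dwv Dwμ Dvμ
    -- the source filter and the computation of `Jstep`
    have hfilt : U.filter (fun e => sqNormInt (e - t₂) = 18) = {c} := by
      rw [hE]; exact (filter_evenCap (Pc x) hPx t₁ ht₁ t₂ ht₂ c hcP h12 hhex hc hc1 hc2).2.1
    have hI : Jstep Pc nb ⟨x, t₁, t₂, U⟩ =
        ⟨nb x t₂, v - w, -w, ({μ - w, μ - v, μ} : Finset (Fin 3 → ℤ))⟩ := by
      have h1 : Jstep Pc nb ⟨x, t₁, t₂, U⟩ =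
          ⟨nb x t₂, v - w, -w, capWithAny (Pc (nb x t₂)) (v - w) (-w) {μ}⟩ := by
        simp only [Jstep, hfilt, Finset.image_singleton]
        try rfl
      rw [h1, hcap]
    have hparx : frameParity t₁ t₂ U = 1 := by
      rw [hE]; exact (isFrame_evenCap (Pc x) hPx t₁ ht₁ t₂ ht₂ c hcP h12 hhex hc hc1 hc2).2
    -- in the even cap `{c'', c'' - a, c'' - b}` (`a = v - w`, `b = -w`, `c'' = μ - w`) the element touching `-b = w` is `c'' - b = μ`
    have hapoff' : μ - w ∉ hexLabels (v - w) (-w) := by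
      obtain ⟨-, -, -, hoff', _⟩ := id hframe
      exact hoff' (μ - w) (by simp)
    have hfilt' : ({μ - w, μ - v, μ} : Finset (Fin 3 → ℤ)).filter (fun e => sqNormInt (e + -w) = 18) = {μ} := by
      have := (filter_evenCap (Pc (nb x t₂)) hPy (v - w)
        (hhexwv (mem_hexLabels_iff.2 (Or.inr (Or.inr (Or.inl rfl))))) (-w) hnw (μ - w) hμw
        (by rw [show v - w - -w = v by abel]; exact chart_sqNormInt_eq hch hy.1 hv.1)
        hframe.2.1 hapoff' (by rw [show μ - w - (v - w) = μ - v by abel]; exact hμv)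
        (by rw [show μ - w - -w = μ by abel]; exact hμ.1)).2.2.2
      rw [show μ - w - -w = μ by abel, show μ - w - (v - w) = μ - v by abel] at this
      exact this
    refine ⟨hy.1, hy.2, hw.1, hw.2, hv.1, hv.2, hnw, hnv, Dwv, hκeq, htype, ?_, ?_, c, hcU,
      (by rw [sqNormInt_sub_comm]; exact hdx.1), hfilt, hbu, ?_, ?_, ?_⟩
    · rw [hI]; exact hframe
    · rw [hI, hparx]; exact hpar
    · rw [hI]; show μ ∈ _; simp
    · rw [hI]; exact hcap.symm
    · rw [hI]; exact hfilt'
  · /- ODD source cap `U = {c, c + t₁, c + t₂}`: reference `c₂ = c + t₂` -/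
    have hc1 : c + t₁ ∈ Pc x := hUP (by rw [hO]; simp)
    have hc2 : c + t₂ ∈ Pc x := hUP (by rw [hO]; simp)
    have hdx := dist_oddCap (Pc x) hPx t₁ ht₁ t₂ ht₂ c hcP h12 hhex hc hc1 hc2
    -- `c + t₂ ~ t₂` and `c + t₂ ~ t₂ - t₁`
    have h_c1t1 : sqNormInt (c + t₂ - t₂) = 18 := by
      rw [add_sub_cancel_right]; exact chart_sqNormInt_eq hch hx hcP
    have hbu : B (nb x t₂) (nb x (c + t₂)) :=
      (bond_nb_iff hch hx ht₂ hc2).2 (by rw [sqNormInt_sub_comm]; exact h_c1t1)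
    have hμ := zlab_spec hch hy.1 (nb_mem hch hx hc2).1 hbu
    set μ := zlab Pc nb (nb x t₂) (nb x (c + t₂)) with hμ_def
    have Dμw : sqNormInt (μ - w) = 18 := by
      rw [hμ_def, hw_def, transfer_nb_centre hch hx hy.1 hy.2 hc2 hbu]
      exact chart_sqNormInt_eq hch hx hc2
    have Dwμ : sqNormInt (w - μ) = 18 := by rw [sqNormInt_sub_comm]; exact Dμw
    have Dκμ : sqNormInt (κ - μ) = 18 := by
      rw [hκ_def, hμ_def, transfer_nb_nb hch hx hy.1 hy.2 ht21 hc2 hbK hbu]; exact hdx.2.2.2.2.2.2.2.1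
    have Dvμ : sqNormInt (v - μ) = 36 := by
      rw [hv_def, hμ_def, transfer_nb_nb hch hx hy.1 hy.2 ht₁ hc2 hbJ hbu]; exact hdx.2.2.2.2.2.1
    -- regime: symmetric labels at `y` and type propagation
    have hsym : -w ∈ Pc (nb x t₂) ∧ -v ∈ Pc (nb x t₂) ∧ (Pc x = hcpInt → Pc (nb x t₂) = hcpInt) := by
      by_cases hxh : Pc x = hcpInt
      · have hfr : ∀ q, q ∈ hcpInt ↔ q ∈ Pc x := fun q => by rw [hxh]
        obtain ⟨d, hd, h48, hd1, hd2, hdoff, hL⟩ := lowerCap_oddCap_hcp t₁ ((hfr _).2 ht₁) t₂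
          ((hfr _).2 ht₂) c ((hfr _).2 hcP) h12 (by rw [hxh] at hhex; exact hhex) hc
          ((hfr _).2 hc1) ((hfr _).2 hc2)
        have hdP : d ∈ Pc x := (hfr d).1 (mem_lowerCap_iff.1 hd).1
        have hd2P : d + t₂ ∈ Pc x := (hfr _).1 hd2
        have hdx' := dist_oddCap (Pc x) hPx t₁ ht₁ t₂ ht₂ d hdP h12 hhex hdoff ((hfr _).1 hd1) hd2P
        -- the lower reference `l = nb x (d + t₂)`, mirror partner of `u = nb x (c + t₂)`
        have h48' : sqNormInt (c + t₂ - (d + t₂)) = 48 := by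
          rw [show c + t₂ - (d + t₂) = c - d by abel]; exact h48
        have hbl : B (nb x t₂) (nb x (d + t₂)) :=
          (bond_nb_iff hch hx ht₂ hd2P).2 (by
            rw [sqNormInt_sub_comm, add_sub_cancel_right]; exact chart_sqNormInt_eq hch hx hdP)
        obtain ⟨hPy', heq⟩ := hcp_of_mirror_pair hch hx ht₂ hc2 hd2P h48' hbu hbl
        have hlam := zlab_spec hch hy.1 (nb_mem hch hx hd2P).1 hbl
        have Dwlam : sqNormInt (w - zlab Pc nb (nb x t₂) (nb x (d + t₂))) = 18 := by
          rw [sqNormInt_sub_comm, hw_def, transfer_nb_centre hch hx hy.1 hy.2 hd2P hbl]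
          exact chart_sqNormInt_eq hch hx hd2P
        have Dκlam : sqNormInt (κ - zlab Pc nb (nb x t₂) (nb x (d + t₂))) = 18 := by
          rw [hκ_def, transfer_nb_nb hch hx hy.1 hy.2 ht21 hd2P hbK hbl]; exact hdx'.2.2.2.2.2.2.2.1
        have hnw : -w ∈ Pc (nb x t₂) := heq w hw.1 Dwμ Dwlam
        have hnκ : -κ ∈ Pc (nb x t₂) := heq κ hκ.1 Dκμ Dκlam
        have hnv : -v ∈ Pc (nb x t₂) := by
          have hwP := hw.1; have hκP := hκ.1; have hvP := hv.1
          rw [hPy'] at hwP hκP hvP hnw hnκ ⊢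
          exact neg_mem_of_chain w hwP κ hκP v hvP hnw hnκ Dwv (by rw [sqNormInt_sub_comm]; exact Dκw) Dvκ
        exact ⟨hnw, hnv, fun _ => hPy'⟩
      · have hS : -w ∈ Pc (nb x t₂) ∧ -v ∈ Pc (nb x t₂) := by
          rcases hreg with hA | hB | hS
          · constructor
            · rw [hA] at hw ⊢; exact neg_mem_fcc3Int w hw.1
            · rw [hA] at hv ⊢; exact neg_mem_fcc3Int v hv.1
          · exact (hxh hB).elim
          · exact hS
        exact ⟨hS.1, hS.2, fun h => (hxh h).elim⟩
    obtain ⟨hnw, hnv, htype⟩ := hsym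
    have hhexwv : hexLabels w v ⊆ Pc (nb x t₂) :=
      hexLabels_subset_of_symm (Pc (nb x t₂)) hPy w hw.1 v hv.1 Dwv hnw hnv
    have hwv : w - v ∈ Pc (nb x t₂) :=
      hhexwv (mem_hexLabels_iff.2 (Or.inr (Or.inr (Or.inr (Or.inr (Or.inr rfl))))))
    have hκeq : κ = w - v :=
      label_third_vertex (Pc (nb x t₂)) hPy v hv.1 w hw.1 κ hκ.1 Dvw Dκw Dκv hwv
    have Dwvμ : sqNormInt (w - v - μ) = 18 := by rw [← hκeq]; exact Dκμ
    obtain ⟨hframe, hpar, hcap⟩ :=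
      apex_J_odd (Pc (nb x t₂)) hPy w hw.1 v hv.1 μ hμ.1 hnw hnv Dwv Dwμ Dwvμ Dvμ
    have hfilt : U.filter (fun e => sqNormInt (e - t₂) = 18) = {c + t₂} := by
      rw [hO]; exact (filter_oddCap (Pc x) hPx t₁ ht₁ t₂ ht₂ c hcP h12 hhex hc hc1 hc2).2.1
    have hI : Jstep Pc nb ⟨x, t₁, t₂, U⟩ =
        ⟨nb x t₂, v - w, -w, ({μ, μ + v - w, μ - w} : Finset (Fin 3 → ℤ))⟩ := by
      have h1 : Jstep Pc nb ⟨x, t₁, t₂, U⟩ =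
          ⟨nb x t₂, v - w, -w, capWithAny (Pc (nb x t₂)) (v - w) (-w) {μ}⟩ := by
        simp only [Jstep, hfilt, Finset.image_singleton]
        try rfl
      rw [h1, hcap]
    have hparx : frameParity t₁ t₂ U = -1 := by
      rw [hO]; exact (isFrame_oddCap (Pc x) hPx t₁ ht₁ t₂ ht₂ c hcP h12 hhex hc hc1 hc2).2
    -- in the odd cap `{μ, μ + a, μ + b}` (`a = v - w`, `b = -w`) the element touching `-b = w` is `μ`
    have hfilt' : ({μ, μ + v - w, μ - w} : Finset (Fin 3 → ℤ)).filter (fun e => sqNormInt (e + -w) = 18) = {μ} := by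
      obtain ⟨-, -, -, hoff', _⟩ := id hframe
      have hμoff : μ ∉ hexLabels (v - w) (-w) := hoff' μ (by simp)
      have := (filter_oddCap (Pc (nb x t₂)) hPy (v - w)
        (hhexwv (mem_hexLabels_iff.2 (Or.inr (Or.inr (Or.inl rfl))))) (-w) hnw μ hμ.1
        (by rw [show v - w - -w = v by abel]; exact chart_sqNormInt_eq hch hy.1 hv.1)
        hframe.2.1 hμoff (by rw [show μ + (v - w) = μ + v - w by abel]; exact hframe.2.2.1 (by simp))
        (by rw [show μ + -w = μ - w by abel]; exact hframe.2.2.1 (by simp))).2.2.2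
      rw [show μ + -w = μ - w by abel, show μ + (v - w) = μ + v - w by abel] at this
      exact this
    refine ⟨hy.1, hy.2, hw.1, hw.2, hv.1, hv.2, hnw, hnv, Dwv, hκeq, htype, ?_, ?_, c + t₂,
      (by rw [hO]; simp), h_c1t1, hfilt, hbu, ?_, ?_, ?_⟩
    · rw [hI]; exact hframe
    · rw [hI, hparx]; exact hpar
    · rw [hI]; show μ ∈ _; simp
    · rw [hI]; exact hcap.symm
    · rw [hI]; exact hfilt'

omit hch in
/-! ## Registered anchor (closed form) -/

omit hch in
/-- **Closed form of `Jstep_spec`** (the registered anchor of this file): the section data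
`S, B, Pc, nb` and the standing hypothesis written out, the frame packaged as a `ZFrame`
and the validity hypotheses of the transported frames as one quantified clause. [folklore] -/
theorem Jstep_spec_graded :
    ∀ {S : ℕ → Set (EuclideanSpace ℝ (Fin 3))} {B : EuclideanSpace ℝ (Fin 3) → EuclideanSpace ℝ
    (Fin 3) → Prop} {Pc : EuclideanSpace ℝ (Fin 3) → Finset (Fin 3 → ℤ)} {nb : EuclideanSpace ℝ
    (Fin 3) → (Fin 3 → ℤ) → EuclideanSpace ℝ (Fin 3)}, ((∀ n : ℕ, ∀ z ∈ S n, (Pc z =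
    Summit.AtomisticToContinuum.Crystallization.Theorems.PalmUnimodularRigidityShellsToBarlowChart.fcc3Int
    ∨ Pc z = Literature.Geometry.DiscreteGeometry.hcpInt) ∧ Set.BijOn (nb z) (↑(Pc z) : Set (Fin
    3 → ℤ)) {y | B z y} ∧ ∀ t ∈ Pc z, ∀ t' ∈ Pc z, (B (nb z t) (nb z t') ↔
    Literature.Geometry.DiscreteGeometry.sqNormInt (t - t') = 18)) ∧ (∀ n : ℕ, ∀ z ∈ S (n + 1),
    ∀ y, B z y → y ∈ S n) ∧ (∀ n m : ℕ, ∀ x ∈ S n, ∀ y ∈ S m, B x y → ∀ (z z' : EuclideanSpace ℝ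
    (Fin 3)) (t t' u u' : Fin 3 → ℤ), (t = 0 ∧ z = x ∨ t ∈ Pc x ∧ z = nb x t) → (t' = 0 ∧ z' = x
    ∨ t' ∈ Pc x ∧ z' = nb x t') → (u = 0 ∧ z = y ∨ u ∈ Pc y ∧ z = nb y u) → (u' = 0 ∧ z' = y ∨
    u' ∈ Pc y ∧ z' = nb y u') → Literature.Geometry.DiscreteGeometry.sqNormInt (u - u') =
    Literature.Geometry.DiscreteGeometry.sqNormInt (t - t')) ∧ (∀ x y, B x y → B y x)) → ∀ (n :
    ℕ) (f :
    Summit.AtomisticToContinuum.Crystallization.Theorems.PalmUnimodularRigidityShellsToBarlowChart.ZFrame),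
    f.pt ∈ S (n + 1) → (∀ g :
    Summit.AtomisticToContinuum.Crystallization.Theorems.PalmUnimodularRigidityShellsToBarlowChart.ZFrame,
    g = f →
    Summit.AtomisticToContinuum.Crystallization.Theorems.PalmUnimodularRigidityShellsToBarlowChart.IsFrame
    (Pc g.pt) g.t₁ g.t₂ g.U) → Pc (nb f.pt f.t₂) =
    Summit.AtomisticToContinuum.Crystallization.Theorems.PalmUnimodularRigidityShellsToBarlowChart.fcc3Int
    ∨ Pc f.pt = Literature.Geometry.DiscreteGeometry.hcpInt ∨
    (-Summit.AtomisticToContinuum.Crystallization.Theorems.PalmUnimodularRigidityShellsToBarlowChart.zlab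
    Pc nb (nb f.pt f.t₂) f.pt ∈ Pc (nb f.pt f.t₂) ∧
    -Summit.AtomisticToContinuum.Crystallization.Theorems.PalmUnimodularRigidityShellsToBarlowChart.zlab
    Pc nb (nb f.pt f.t₂) (nb f.pt f.t₁) ∈ Pc (nb f.pt f.t₂)) → nb f.pt f.t₂ ∈ S n ∧
    Summit.AtomisticToContinuum.Crystallization.Theorems.PalmUnimodularRigidityShellsToBarlowChart.IsFrame
    (Pc (nb f.pt f.t₂))
    (Summit.AtomisticToContinuum.Crystallization.Theorems.PalmUnimodularRigidityShellsToBarlowChart.Jstep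
    Pc nb f).t₁
    (Summit.AtomisticToContinuum.Crystallization.Theorems.PalmUnimodularRigidityShellsToBarlowChart.Jstep
    Pc nb f).t₂
    (Summit.AtomisticToContinuum.Crystallization.Theorems.PalmUnimodularRigidityShellsToBarlowChart.Jstep
    Pc nb f).U ∧
    Summit.AtomisticToContinuum.Crystallization.Theorems.PalmUnimodularRigidityShellsToBarlowChart.frameParity
    (Summit.AtomisticToContinuum.Crystallization.Theorems.PalmUnimodularRigidityShellsToBarlowChart.Jstep
    Pc nb f).t₁
    (Summit.AtomisticToContinuum.Crystallization.Theorems.PalmUnimodularRigidityShellsToBarlowChart.Jstep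
    Pc nb f).t₂
    (Summit.AtomisticToContinuum.Crystallization.Theorems.PalmUnimodularRigidityShellsToBarlowChart.Jstep
    Pc nb f).U =
    Summit.AtomisticToContinuum.Crystallization.Theorems.PalmUnimodularRigidityShellsToBarlowChart.frameParity
    f.t₁ f.t₂ f.U := by
  intro S B Pc nb hch n f hx hval hreg
  obtain ⟨x, t₁, t₂, U⟩ := f
  have h := Jstep_spec hch hx (hval _ rfl) hreg
  exact ⟨h.1, h.2.2.2.2.2.2.2.2.2.2.2.1, h.2.2.2.2.2.2.2.2.2.2.2.2.1⟩

end Summit.AtomisticToContinuum.Crystallization.Theorems.SquareWellLayerCakeGapTwelveToBarlow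

end
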